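import Summits.KontsevichZagierPeriods.KontsevichZagierPeriods.Theorems.TerasomaMultiplicationBetaCancellationStubTameFormAux23

/-!
# `BetaCancellation` (stmt-KontsevichZagierPeriods-13633), line `divisor-slicing-transshipment` — stub `stub_tameForm`, auxiliary file 24: the shadow of one Newton–Leibniz band, by the sign of `f`

For a band `T = {(x,t) | x ∈ S, lo x < t < hi x}` of an adapted decomposition inside a
Newton–Leibniz band, the integrand `f = ∂F/∂t` has constant sign on `T`. In each of the three
cases the boundary-term representation `Q = (S × (0,1), F(·,hi) − F(·,lo))` exists and
`[T, f] − [Q]` has vanishing shadow: `f > 0` is auxiliary file 22; `f < 0` follows by applying it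
to `−F` and the negative-pair shadows; `f = 0` makes `F` constant along the fibres (mean value
theorem), so both representations have zero integrand.

References: M. Kontsevich, D. Zagier, *Periods* (2001), §1.2 rule (3); crux NOTES c6 (F13).
-/

noncomputable section

-- `Summit.KontsevichZagierPeriods.KontsevichZagierPeriods.…` is the tree's mandated layout (single-conjunct summit).
set_option linter.dupNamespace false

namespace Summit.KontsevichZagierPeriods.KontsevichZagierPeriods.BetaCancellationDivisorSlicing

open MeasureTheory Set Function Filter
open scoped Topology
open Literature.NumberTheory.Transcendental
open Literature.NumberTheory.Transcendental.KZ
open Literature.ModelTheory.ExponentialFields (IsSemialgebraic isSemialgebraic_univ)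

variable {n : ℕ}

/-- Zero derivative on the open fibre and continuity on the closed fibre make `F` constant on it.
[folklore] -/
theorem fibre_const {lo hi : ℝ} (hlh : lo < hi) {φ : ℝ → ℝ} (hc : ContinuousOn φ (Icc lo hi))
    (hd : ∀ t ∈ Ioo lo hi, HasDerivAt φ 0 t) : φ hi = φ lo := by
  have hdiff : DifferentiableOn ℝ φ (interior (Icc lo hi)) := by
    rw [interior_Icc]; exact fun t ht => (hd t ht).differentiableAt.differentiableWithinAt
  have h0 : ∀ t ∈ interior (Icc lo hi), deriv φ t = 0 := by
    rw [interior_Icc]; exact fun t ht => (hd t ht).deriv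
  have h1 := monotoneOn_of_deriv_nonneg (convex_Icc lo hi) hc hdiff (fun t ht => (h0 t ht).ge)
    (left_mem_Icc.mpr hlh.le) (right_mem_Icc.mpr hlh.le) hlh.le
  have h2 := antitoneOn_of_deriv_nonpos (convex_Icc lo hi) hc hdiff (fun t ht => (h0 t ht).le)
    (left_mem_Icc.mpr hlh.le) (right_mem_Icc.mpr hlh.le) hlh.le
  exact le_antisymm h2 h1

/-- **The shadow of one Newton–Leibniz band.** [cite: KontsevichZagier2001, §1.2 rule (3)] -/
theorem exists_bandShadow {S : Set (Fin n → ℝ)} (hSo : IsOpen S) (hS : IsSemialgebraic ℚ S)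
    {lo hi : (Fin n → ℝ) → ℝ} (hlo : IsSemialgebraicFunOn ℚ S lo) (hhi : IsSemialgebraicFunOn ℚ S hi)
    (hloc : ContinuousOn lo S) (hhic : ContinuousOn hi S) (hlh : ∀ x ∈ S, lo x < hi x)
    (RT : IntegralRep (n + 1)) (hRT : RT.domain = {z : Fin (n + 1) → ℝ | (Fin.init z : Fin n → ℝ) ∈ S ∧
      lo (Fin.init z) < z (Fin.last n) ∧ z (Fin.last n) < hi (Fin.init z)})
    {F : (Fin (n + 1) → ℝ) → ℝ} (hFs : IsSemialgebraicFunOn ℚ RT.domain F)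
    (hFd : ∀ z ∈ RT.domain, DifferentiableAt ℝ F z)
    (hFc : ∀ x ∈ S, ContinuousOn (fun t => F (Fin.snoc x t)) (Icc (lo x) (hi x)))
    (hFt : ∀ x ∈ S, ∀ t ∈ Ioo (lo x) (hi x), HasDerivAt (fun s => F (Fin.snoc x s)) (RT.integrand (Fin.snoc x t)) t)
    (hsign : (∀ z ∈ RT.domain, 0 < RT.integrand z) ∨ (∀ z ∈ RT.domain, RT.integrand z < 0) ∨
      (∀ z ∈ RT.domain, RT.integrand z = 0))
    (hGlo : IsSemialgebraicFunOn ℚ S (fun x => F (Fin.snoc x (lo x))))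
    (hGhi : IsSemialgebraicFunOn ℚ S (fun x => F (Fin.snoc x (hi x))))
    (hGlod : DifferentiableOn ℝ (fun x => F (Fin.snoc x (lo x))) S)
    (hGhid : DifferentiableOn ℝ (fun x => F (Fin.snoc x (hi x))) S) :
    ∃ Q : IntegralRep (n + 1), Q.domain = {z : Fin (n + 1) → ℝ | (Fin.init z : Fin n → ℝ) ∈ S ∧
        z (Fin.last n) ∈ Ioo (0 : ℝ) 1} ∧
      (Q.integrand = fun z => F (Fin.snoc (Fin.init z) (hi (Fin.init z))) - F (Fin.snoc (Fin.init z) (lo (Fin.init z)))) ∧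
      Nonempty (Shadow (of RT - of Q)) := by
  have hmemT : ∀ x ∈ S, ∀ t ∈ Ioo (lo x) (hi x), (Fin.snoc x t : Fin (n + 1) → ℝ) ∈ RT.domain := fun x hx t ht => by
    rw [hRT]; simpa using ⟨hx, ht.1, ht.2⟩
  rcases hsign with hpos | hneg | hzero
  · -- `f > 0`
    exact exists_straightenShadow hSo hS hlo hhi hloc hhic hlh RT hRT hFs hFd hFc hFt
      (fun x hx t ht => hpos _ (hmemT x hx t ht)) hGlo hGhi hGlod hGhid
  · -- `f < 0`: straighten `−F`
    obtain ⟨Qm, hQmd, hQmi, ⟨Sm⟩⟩ := exists_straightenShadow hSo hS hlo hhi hloc hhic hlh RT.neg hRT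
      (F := fun z => -F z) hFs.neg (fun z hz => (hFd z hz).neg) (fun x hx => (hFc x hx).neg)
      (fun x hx t ht => by have h := (hFt x hx t ht).neg; exact h)
      (fun x hx t ht => by simpa using hneg _ (hmemT x hx t ht)) hGlo.neg hGhi.neg hGlod.neg hGhid.neg
    refine ⟨Qm.neg, hQmd, ?_, ?_⟩
    · simp only [IntegralRep.integrand_neg, hQmi]; funext z; simp only [Pi.neg_apply]; ring
    · obtain ⟨S1⟩ := Shadow.of_neg_pair (r := RT) (r' := RT.neg) rfl (fun _ _ => rfl)
      obtain ⟨S2⟩ := Shadow.of_neg_pair (r := Qm) (r' := Qm.neg) rfl (fun _ _ => rfl)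
      obtain ⟨S3⟩ := (S1.sub Sm)
      obtain ⟨S4⟩ := S3.sub S2
      exact S4.congr (by abel)
  · -- `f = 0`: both integrands vanish
    have hconst : ∀ x ∈ S, F (Fin.snoc x (hi x)) = F (Fin.snoc x (lo x)) := fun x hx =>
      fibre_const (hlh x hx) (hFc x hx) fun t ht => by
        have := hFt x hx t ht
        rwa [hzero _ (hmemT x hx t ht)] at this
    have hQd : IsSemialgebraic ℚ {z : Fin (n + 1) → ℝ | (Fin.init z : Fin n → ℝ) ∈ S ∧ z (Fin.last n) ∈ Ioo (0 : ℝ) 1} := by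
      have : {z : Fin (n + 1) → ℝ | (Fin.init z : Fin n → ℝ) ∈ S ∧ z (Fin.last n) ∈ Ioo (0 : ℝ) 1} = stabSet n.le_succ S := by
        ext z; rw [mem_stabSet_succ]; rfl
      rw [this]; exact isSemialgebraic_stabSet _ hS
    have hQs : IsSemialgebraicFunOn ℚ {z : Fin (n + 1) → ℝ | (Fin.init z : Fin n → ℝ) ∈ S ∧ z (Fin.last n) ∈ Ioo (0 : ℝ) 1}
        (fun z => F (Fin.snoc (Fin.init z) (hi (Fin.init z))) - F (Fin.snoc (Fin.init z) (lo (Fin.init z)))) :=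
      (IsSemialgebraicFunOn.sub_holds hGhi hGlo).comp_init_mono hQd fun _ h => h.1
    have hz : EqOn (fun z : Fin (n + 1) → ℝ => F (Fin.snoc (Fin.init z) (hi (Fin.init z))) -
        F (Fin.snoc (Fin.init z) (lo (Fin.init z)))) 0
        {z : Fin (n + 1) → ℝ | (Fin.init z : Fin n → ℝ) ∈ S ∧ z (Fin.last n) ∈ Ioo (0 : ℝ) 1} := fun z hz => by
      simp only [Pi.zero_apply, hconst _ hz.1, sub_self]
    have hQi : IntegrableOn (fun z : Fin (n + 1) → ℝ => F (Fin.snoc (Fin.init z) (hi (Fin.init z))) -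
        F (Fin.snoc (Fin.init z) (lo (Fin.init z))))
        {z : Fin (n + 1) → ℝ | (Fin.init z : Fin n → ℝ) ∈ S ∧ z (Fin.last n) ∈ Ioo (0 : ℝ) 1} :=
      integrableOn_zero.congr_fun hz.symm
        (Literature.ModelTheory.ExponentialFields.IsSemialgebraic.measurableSet_holds hQd)
    obtain ⟨Q, hQdom, hQint⟩ := Shadow.exists_rep hQd hQs hQi
    refine ⟨Q, hQdom, hQint, ?_⟩
    obtain ⟨S1⟩ := Shadow.of_eqOn_zero RT fun z hz => hzero z hz
    obtain ⟨S2⟩ := Shadow.of_eqOn_zero Q (by rw [hQdom, hQint]; exact hz)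
    exact S1.sub S2

/-! ### Headline -/

/-- Registered helper goal of the stub `stub_tameForm`: zero derivative inside and continuity on
the closed fibre make a function constant on it. [folklore] -/
theorem tameForm_aux_fibreConst : ∀ {lo hi : ℝ}, lo < hi → ∀ {φ : ℝ → ℝ}, ContinuousOn φ (Set.Icc lo hi) → (∀ t ∈ Set.Ioo lo hi, HasDerivAt φ 0 t) → φ hi = φ lo :=
  fun hlh _ hc hd => fibre_const hlh hc hd

end Summit.KontsevichZagierPeriods.KontsevichZagierPeriods.BetaCancellationDivisorSlicing

end
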